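import Summits.HodgeConjecture.HodgeConjecture.Theorems.HLiu418UndoubleConj
import HarnessLib

/-!
# Crux `HLiu418`, K-lane E3 ROAD U, piece (U3) — ADAPTER to the ROAD-U pen's conventions (★ `DoubledWeilMirrorPrep`)

Cell `hodgecm-mathlib`, FLOOR 0, programme P5 (`F0_AlbCm`); crux item `stmt-HodgeConjecture-24832`; seat A-p02 (g19);
`--supports stmt-HodgeConjecture-24832` (helper).  THEOREMS ONLY — no definition, no instance, no notation, no named-fact hypothesis,
no `sorry`.  Sequel of ★ `Theorems/HLiu418UndoubleConj` (p810422): the same statement «undoubling commutes with scalar conjugation»,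
re-spelled so that the ROAD-U pen (F0P5-p04 (g3), ★ `Theorems/HLiu418DoubledWeilMirrorPrep` p810623, `…DoubledWeilMirror`) can cite it
TOKEN FOR TOKEN:

* §1 **for ANY twisted homomorphism `sD′ : H_{dW′}(𝔸) →* Mp(𝕎^𝔻_{dW′})ᶜᵒⁿᵗ` that is POINTWISE `mpCongr ((sD (θ h))ᶜ)`** (`hsD′`) — so neither the
  bracketing of the composite `mpCongr ∘ (·)ᶜ ∘ sD ∘ θ` nor the proof fed to `mpCongr` matters (`undouble_of_eq_mpCongr_conj`,
  `undoubleHom_of_eq_mpCongr_conj`; by `subst` from ★ `UndoubleConj.undouble_mpCongr_conj_comp`);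
* §2 **in the pen's spelling**: `hneg : realDiagonal L dW′ hdW′ = −realDiagonal L dW hdW` (primed frame on the left), `hθ` ∕ `hθ₁` at the
  MATRIX level, the composite bracketed `((mpCongr (gramDA_eq_neg hneg).symm) ∘ ((·)ᶜ ∘ sD)) ∘ θ` exactly as in ★ `DoubledWeilMirror.proj_mirror`
  (`undouble_mirror`, `undoubleHom_mirror`), and the instance at the casts of record `subgroupCongr (HA_eq hneg)` ∕ `subgroupCongr (adelicPair_eq …)`
  (`undoubleHom_mirror_subgroupCongr`, with `hproj′` discharged by ★ `DoubledWeilMirror.proj_mirror`-shaped input or by §1).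
HONEST LABEL: HC_CM is proved only modulo the 7 printed citations (+ declared floor-0 debt) until rung 0 closes; this file discharges
none of them.

References: [Kudla1994] S. Kudla, Israel J. Math. 87 (1994), §2, §3 Thm. 3.1; [Li1992] J.-S. Li, J. reine angew. Math. 428 (1992), p. 181;
[GelbartRogawski1991] S. Gelbart, J. Rogawski, Invent. Math. 105 (1991), §3.1 p. 454; [MoeglinVignerasWaldspurger1987] LNM 1291, Chap. 2 II.1.
-/

set_option autoImplicit false
-- the mandated namespace has the single-problem summit's repeated segment (`HodgeConjecture.HodgeConjecture`)
set_option linter.dupNamespace false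

noncomputable section

open scoped Classical
open scoped Matrix ComplexConjugate
open NumberField IsDedekindDomain
open Literature.RepresentationTheory.HeisenbergGroup
open Literature.NumberTheory.Automorphic
open Literature.NumberTheory.Weil1964
open Literature.NumberTheory.GaloisRepresentations
open Literature.NumberTheory.GelbartRogawski1991
open Literature.NumberTheory.GelbartRogawski1991.GRConstruction
open Literature.NumberTheory.GelbartRogawski1991.UnitaryDualPair
open Literature.NumberTheory.Automorphic.UnitaryGroup

namespace Summit.HodgeConjecture.HodgeConjecture.Cruxes.HLiu418.UndoubleConj

variable {L : Type} [Field L] [NumberField L] [IsCMField L]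
  {N M n : ℕ} {e : Fin N × Fin M ≃ Fin n}
  {dV : Fin N → L} {hdV : ∀ i, IsCMField.complexConj L (dV i) = dV i}
  {dW : Fin M → L} {hdW : ∀ i, IsCMField.complexConj L (dW i) = dW i}
  {dW' : Fin M → L} {hdW' : ∀ i, IsCMField.complexConj L (dW' i) = dW' i}

/-! ## §1 Any twisted homomorphism that is pointwise `mpCongr ((sD (θ h))ᶜ)` -/

/-- **(U3) for ANY `sD′` pointwise equal to `mpCongr ((sD (θ h))ᶜ)`** (bracketing- and proof-independent form of ★ `undouble_mpCongr_conj_comp`):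
`undouble_{dW′} sD′ g = mpCongr ((undouble_{dW} sD (θ₁ g))ᶜ)`. [cite: Kudla1994, §2 (doubled space, Siegel parabolic), Thm. 3.1] [cite: Li1992, p. 181] -/
theorem undouble_of_eq_mpCongr_conj (hdV0 : ∀ i, dV i ≠ 0) (hdW0 : ∀ i, dW i ≠ 0) (hdW0' : ∀ i, dW' i ≠ 0)
    (hneg : realDiagonal L dW hdW = -realDiagonal L dW' hdW')
    (θ : HA L e dV hdV dW' hdW' →* HA L e dV hdV dW hdW)
    (hθ : ∀ h, ((θ h : HA L e dV hdV dW hdW) : GL (Fin (n + n)) (AdeleRing (𝓞 L) L)) = h)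
    (θ₁ : adelicPair (Fp L) L (IsCMField.complexConj L) N M (Matrix.diagonal dV) (Matrix.diagonal dW') →
      adelicPair (Fp L) L (IsCMField.complexConj L) N M (Matrix.diagonal dV) (Matrix.diagonal dW))
    (hθ₁ : ∀ g, ((θ₁ g : adelicPair (Fp L) L (IsCMField.complexConj L) N M (Matrix.diagonal dV) (Matrix.diagonal dW)) :
      GL (Fin N × Fin M) (AdeleRing (𝓞 L) L)) = g)
    {sD : HA L e dV hdV dW hdW →* MpD L e dV hdV dW hdW} (hproj : ∀ h, projD L e dV hdV dW hdW (sD h) = toSpD L e dV hdV dW hdW h)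
    {sD' : HA L e dV hdV dW' hdW' →* MpD L e dV hdV dW' hdW'}
    (hsD' : ∀ h, sD' h = mpCongr (neg_gramDA_eq (e := e) (dV := dV) (hdV := hdV) hneg)
      (adelicMpContConj (Fp L) (Fin (n + n)) (gramDA L e dV hdV dW hdW) (sD (θ h))))
    (hproj' : ∀ h, projD L e dV hdV dW' hdW' (sD' h) = toSpD L e dV hdV dW' hdW' h)
    (g : adelicPair (Fp L) L (IsCMField.complexConj L) N M (Matrix.diagonal dV) (Matrix.diagonal dW')) :
    undouble L e dV hdV hdV0 dW' hdW' hdW0' hproj' g =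
      mpCongr (neg_gramA_eq (e := e) (dV := dV) (hdV := hdV) hneg)
        (adelicMpContConj (Fp L) (Fin n) (gramA L e dV hdV dW hdW) (undouble L e dV hdV hdV0 dW hdW hdW0 hproj (θ₁ g))) := by
  have hsD'eq : sD' = (mpCongr (neg_gramDA_eq (e := e) (dV := dV) (hdV := hdV) hneg)).toMonoidHom.comp
      (((adelicMpContConj (Fp L) (Fin (n + n)) (gramDA L e dV hdV dW hdW)).toMonoidHom.comp sD).comp θ) :=
    MonoidHom.ext hsD'
  subst hsD'eq
  exact undouble_mpCongr_conj_comp hdV0 hdW0 hdW0' hneg θ hθ θ₁ hθ₁ hproj hproj' g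

/-- Hom form of `undouble_of_eq_mpCongr_conj`: **`undoubleHom sD′ = mpCongr ∘ (·)ᶜ ∘ undoubleHom sD ∘ θ₁`**.
[cite: Kudla1994, §2 (doubled space, Siegel parabolic), Thm. 3.1] [cite: Li1992, p. 181] -/
theorem undoubleHom_of_eq_mpCongr_conj (hdV0 : ∀ i, dV i ≠ 0) (hdW0 : ∀ i, dW i ≠ 0) (hdW0' : ∀ i, dW' i ≠ 0)
    (hneg : realDiagonal L dW hdW = -realDiagonal L dW' hdW')
    (θ : HA L e dV hdV dW' hdW' →* HA L e dV hdV dW hdW)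
    (hθ : ∀ h, ((θ h : HA L e dV hdV dW hdW) : GL (Fin (n + n)) (AdeleRing (𝓞 L) L)) = h)
    (θ₁ : adelicPair (Fp L) L (IsCMField.complexConj L) N M (Matrix.diagonal dV) (Matrix.diagonal dW') →*
      adelicPair (Fp L) L (IsCMField.complexConj L) N M (Matrix.diagonal dV) (Matrix.diagonal dW))
    (hθ₁ : ∀ g, ((θ₁ g : adelicPair (Fp L) L (IsCMField.complexConj L) N M (Matrix.diagonal dV) (Matrix.diagonal dW)) :
      GL (Fin N × Fin M) (AdeleRing (𝓞 L) L)) = g)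
    {sD : HA L e dV hdV dW hdW →* MpD L e dV hdV dW hdW} (hproj : ∀ h, projD L e dV hdV dW hdW (sD h) = toSpD L e dV hdV dW hdW h)
    {sD' : HA L e dV hdV dW' hdW' →* MpD L e dV hdV dW' hdW'}
    (hsD' : ∀ h, sD' h = mpCongr (neg_gramDA_eq (e := e) (dV := dV) (hdV := hdV) hneg)
      (adelicMpContConj (Fp L) (Fin (n + n)) (gramDA L e dV hdV dW hdW) (sD (θ h))))
    (hproj' : ∀ h, projD L e dV hdV dW' hdW' (sD' h) = toSpD L e dV hdV dW' hdW' h) :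
    undoubleHom L e dV hdV hdV0 dW' hdW' hdW0' sD' hproj' =
      ((mpCongr (neg_gramA_eq (e := e) (dV := dV) (hdV := hdV) hneg)).toMonoidHom.comp
          (((adelicMpContConj (Fp L) (Fin n) (gramA L e dV hdV dW hdW)).toMonoidHom.comp
            (undoubleHom L e dV hdV hdV0 dW hdW hdW0 sD hproj)))).comp θ₁ :=
  MonoidHom.ext fun g => undouble_of_eq_mpCongr_conj hdV0 hdW0 hdW0' hneg θ hθ θ₁ hθ₁ hproj hsD' hproj' g

/-! ## §2 The ROAD-U pen's spelling (★ `DoubledWeilMirror.proj_mirror`): primed frame on the left, matrix-level `hθ`, his bracketing -/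

/-- **(U3) in the spelling of ★ `DoubledWeilMirror.proj_mirror`**: for `hneg : realDiagonal dW′ = −realDiagonal dW`, `θ`, `θ₁` the identity on
MATRICES, `sD` over `ι^𝔻_{dW}` and the twisted `((mpCongr (gramDA_eq_neg hneg).symm) ∘ ((·)ᶜ ∘ sD)) ∘ θ` over `ι^𝔻_{dW′}` (★ `proj_mirror`):
`undouble_{dW′} (((mpCongr …) ∘ ((·)ᶜ ∘ sD)) ∘ θ) g = mpCongr ((undouble_{dW} sD (θ₁ g))ᶜ)`.
[cite: Kudla1994, §2 (doubled space, Siegel parabolic), Thm. 3.1] [cite: Li1992, p. 181] [cite: GelbartRogawski1991, §3.1 p. 454] -/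
theorem undouble_mirror (hdV0 : ∀ i, dV i ≠ 0) (hdW0 : ∀ i, dW i ≠ 0) (hdW0' : ∀ i, dW' i ≠ 0)
    (hneg : realDiagonal L dW' hdW' = -realDiagonal L dW hdW)
    {θ : HA L e dV hdV dW' hdW' →* HA L e dV hdV dW hdW}
    (hθ : ∀ h : HA L e dV hdV dW' hdW',
      (((θ h : HA L e dV hdV dW hdW) : GL (Fin (n + n)) (AdeleRing (𝓞 L) L)) : Matrix (Fin (n + n)) (Fin (n + n)) (AdeleRing (𝓞 L) L)) =
        (((h : HA L e dV hdV dW' hdW') : GL (Fin (n + n)) (AdeleRing (𝓞 L) L)) : Matrix (Fin (n + n)) (Fin (n + n)) (AdeleRing (𝓞 L) L)))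
    {θ₁ : adelicPair (Fp L) L (IsCMField.complexConj L) N M (Matrix.diagonal dV) (Matrix.diagonal dW') →
      adelicPair (Fp L) L (IsCMField.complexConj L) N M (Matrix.diagonal dV) (Matrix.diagonal dW)}
    (hθ₁ : ∀ g : adelicPair (Fp L) L (IsCMField.complexConj L) N M (Matrix.diagonal dV) (Matrix.diagonal dW'),
      (((θ₁ g : adelicPair (Fp L) L (IsCMField.complexConj L) N M (Matrix.diagonal dV) (Matrix.diagonal dW)) :
        GL (Fin N × Fin M) (AdeleRing (𝓞 L) L)) : Matrix (Fin N × Fin M) (Fin N × Fin M) (AdeleRing (𝓞 L) L)) =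
        (((g : adelicPair (Fp L) L (IsCMField.complexConj L) N M (Matrix.diagonal dV) (Matrix.diagonal dW')) :
          GL (Fin N × Fin M) (AdeleRing (𝓞 L) L)) : Matrix (Fin N × Fin M) (Fin N × Fin M) (AdeleRing (𝓞 L) L)))
    {sD : HA L e dV hdV dW hdW →* MpD L e dV hdV dW hdW} (hproj : ∀ h, projD L e dV hdV dW hdW (sD h) = toSpD L e dV hdV dW hdW h)
    (hproj' : ∀ h, projD L e dV hdV dW' hdW'
      ((((mpCongr (gramDA_eq_neg (e := e) (dV := dV) (hdV := hdV) hneg).symm).toMonoidHom.comp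
        ((adelicMpContConj (Fp L) (Fin (n + n)) (gramDA L e dV hdV dW hdW)).toMonoidHom.comp sD)).comp θ) h) =
      toSpD L e dV hdV dW' hdW' h)
    (g : adelicPair (Fp L) L (IsCMField.complexConj L) N M (Matrix.diagonal dV) (Matrix.diagonal dW')) :
    undouble L e dV hdV hdV0 dW' hdW' hdW0' hproj' g =
      mpCongr (neg_gramA_eq (e := e) (dV := dV) (hdV := hdV) (neg_eq_iff_eq_neg.2 hneg).symm)
        (adelicMpContConj (Fp L) (Fin n) (gramA L e dV hdV dW hdW) (undouble L e dV hdV hdV0 dW hdW hdW0 hproj (θ₁ g))) :=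
  undouble_of_eq_mpCongr_conj hdV0 hdW0 hdW0' (neg_eq_iff_eq_neg.2 hneg).symm θ (fun h => Units.ext (hθ h)) θ₁
    (fun g' => Units.ext (hθ₁ g')) hproj (fun _ => rfl) hproj' g

/-- Hom form of `undouble_mirror`: **`undoubleHom (((mpCongr …) ∘ ((·)ᶜ ∘ sD)) ∘ θ) = ((mpCongr …) ∘ ((·)ᶜ ∘ undoubleHom sD)) ∘ θ₁`** in the pen's
bracketing. [cite: Kudla1994, §2 (doubled space, Siegel parabolic), Thm. 3.1] [cite: Li1992, p. 181] -/
theorem undoubleHom_mirror (hdV0 : ∀ i, dV i ≠ 0) (hdW0 : ∀ i, dW i ≠ 0) (hdW0' : ∀ i, dW' i ≠ 0)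
    (hneg : realDiagonal L dW' hdW' = -realDiagonal L dW hdW)
    {θ : HA L e dV hdV dW' hdW' →* HA L e dV hdV dW hdW}
    (hθ : ∀ h : HA L e dV hdV dW' hdW',
      (((θ h : HA L e dV hdV dW hdW) : GL (Fin (n + n)) (AdeleRing (𝓞 L) L)) : Matrix (Fin (n + n)) (Fin (n + n)) (AdeleRing (𝓞 L) L)) =
        (((h : HA L e dV hdV dW' hdW') : GL (Fin (n + n)) (AdeleRing (𝓞 L) L)) : Matrix (Fin (n + n)) (Fin (n + n)) (AdeleRing (𝓞 L) L)))
    {θ₁ : adelicPair (Fp L) L (IsCMField.complexConj L) N M (Matrix.diagonal dV) (Matrix.diagonal dW') →*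
      adelicPair (Fp L) L (IsCMField.complexConj L) N M (Matrix.diagonal dV) (Matrix.diagonal dW)}
    (hθ₁ : ∀ g : adelicPair (Fp L) L (IsCMField.complexConj L) N M (Matrix.diagonal dV) (Matrix.diagonal dW'),
      (((θ₁ g : adelicPair (Fp L) L (IsCMField.complexConj L) N M (Matrix.diagonal dV) (Matrix.diagonal dW)) :
        GL (Fin N × Fin M) (AdeleRing (𝓞 L) L)) : Matrix (Fin N × Fin M) (Fin N × Fin M) (AdeleRing (𝓞 L) L)) =
        (((g : adelicPair (Fp L) L (IsCMField.complexConj L) N M (Matrix.diagonal dV) (Matrix.diagonal dW')) :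
          GL (Fin N × Fin M) (AdeleRing (𝓞 L) L)) : Matrix (Fin N × Fin M) (Fin N × Fin M) (AdeleRing (𝓞 L) L)))
    {sD : HA L e dV hdV dW hdW →* MpD L e dV hdV dW hdW} (hproj : ∀ h, projD L e dV hdV dW hdW (sD h) = toSpD L e dV hdV dW hdW h)
    (hproj' : ∀ h, projD L e dV hdV dW' hdW'
      ((((mpCongr (gramDA_eq_neg (e := e) (dV := dV) (hdV := hdV) hneg).symm).toMonoidHom.comp
        ((adelicMpContConj (Fp L) (Fin (n + n)) (gramDA L e dV hdV dW hdW)).toMonoidHom.comp sD)).comp θ) h) =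
      toSpD L e dV hdV dW' hdW' h) :
    undoubleHom L e dV hdV hdV0 dW' hdW' hdW0'
        (((mpCongr (gramDA_eq_neg (e := e) (dV := dV) (hdV := hdV) hneg).symm).toMonoidHom.comp
          ((adelicMpContConj (Fp L) (Fin (n + n)) (gramDA L e dV hdV dW hdW)).toMonoidHom.comp sD)).comp θ) hproj' =
      ((mpCongr (neg_gramA_eq (e := e) (dV := dV) (hdV := hdV) (neg_eq_iff_eq_neg.2 hneg).symm)).toMonoidHom.comp
          ((adelicMpContConj (Fp L) (Fin n) (gramA L e dV hdV dW hdW)).toMonoidHom.comp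
            (undoubleHom L e dV hdV hdV0 dW hdW hdW0 sD hproj))).comp θ₁ :=
  MonoidHom.ext fun g => undouble_mirror hdV0 hdW0 hdW0' hneg hθ hθ₁ hproj hproj' g

/-- **(U3) at the casts of record in the pen's orientation**: `θ := subgroupCongr (HA_eq hneg)` (★ `DoubledWeilMirror.coe_subgroupCongr_HA_eq`),
`θ₁ := subgroupCongr (adelicPair_eq …)`. [cite: Kudla1994, §2 (doubled space, Siegel parabolic), Thm. 3.1] [cite: Li1992, p. 181] -/
theorem undoubleHom_mirror_subgroupCongr (hdV0 : ∀ i, dV i ≠ 0) (hdW0 : ∀ i, dW i ≠ 0) (hdW0' : ∀ i, dW' i ≠ 0)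
    (hneg : realDiagonal L dW' hdW' = -realDiagonal L dW hdW)
    {sD : HA L e dV hdV dW hdW →* MpD L e dV hdV dW hdW} (hproj : ∀ h, projD L e dV hdV dW hdW (sD h) = toSpD L e dV hdV dW hdW h)
    (hproj' : ∀ h, projD L e dV hdV dW' hdW'
      ((((mpCongr (gramDA_eq_neg (e := e) (dV := dV) (hdV := hdV) hneg).symm).toMonoidHom.comp
        ((adelicMpContConj (Fp L) (Fin (n + n)) (gramDA L e dV hdV dW hdW)).toMonoidHom.comp sD)).comp
          (MulEquiv.subgroupCongr (HA_eq (e := e) (dV := dV) (hdV := hdV) hneg)).toMonoidHom) h) =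
      toSpD L e dV hdV dW' hdW' h) :
    undoubleHom L e dV hdV hdV0 dW' hdW' hdW0'
        (((mpCongr (gramDA_eq_neg (e := e) (dV := dV) (hdV := hdV) hneg).symm).toMonoidHom.comp
          ((adelicMpContConj (Fp L) (Fin (n + n)) (gramDA L e dV hdV dW hdW)).toMonoidHom.comp sD)).comp
            (MulEquiv.subgroupCongr (HA_eq (e := e) (dV := dV) (hdV := hdV) hneg)).toMonoidHom) hproj' =
      ((mpCongr (neg_gramA_eq (e := e) (dV := dV) (hdV := hdV) (neg_eq_iff_eq_neg.2 hneg).symm)).toMonoidHom.comp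
          ((adelicMpContConj (Fp L) (Fin n) (gramA L e dV hdV dW hdW)).toMonoidHom.comp
            (undoubleHom L e dV hdV hdV0 dW hdW hdW0 sD hproj))).comp
        (MulEquiv.subgroupCongr (adelicPair_eq (dV := dV) hneg)).toMonoidHom :=
  undoubleHom_mirror hdV0 hdW0 hdW0' hneg (fun h => congrArg Units.val (MulEquiv.subgroupCongr_apply _ h))
    (fun g => congrArg Units.val (MulEquiv.subgroupCongr_apply _ g)) hproj hproj'

end Summit.HodgeConjecture.HodgeConjecture.Cruxes.HLiu418.UndoubleConj

end
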